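import Summits.ValiantsHypothesis.ValiantsHypothesis.Theorems.BarrierLeverSuccinctHittingSetsForVPOccurFormulas
import Literature.Computability.AlgebraicComplexity.FSV18CommROABPHolds
import Literature.Computability.AlgebraicComplexity.FSV18Fact19Holds
import Literature.Computability.AlgebraicComplexity.FSV18Lemma23Discharge
import Literature.Computability.AlgebraicComplexity.FSV18SmespDischarge
import Literature.Computability.AlgebraicComplexity.FSV18SparseHittingProofs
import Literature.Computability.AlgebraicComplexity.FSV18SparseTrdegAllFields

/-!
# Crux `BarrierLever.SuccinctHittingSetsForVP` (stmt-ValiantsHypothesis-14610) — UNCONDITIONAL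
# Summits consumers, multilinear frame, of the six DISCHARGED bullets of FSV Thm. 9

Forbes–Shpilka–Volk's Thm. 9 (= ToC Thm. 1.10) has seven bullets; six are THEOREMS of the tree by
name (val-lit NP corpus): `FSV2018_thm9_spsk_holds` (`Σ^kΠΣ`), `FSV2018_thm9_trdeg_holds` (`ΣΠΣ` of
transcendence degree `≤ k`), `FSV2018_thm9_sparse_holds` (`s`-sparse), `FSV2018_thm9_smesp_holds`
(`Σm∧ΣΠ^t`), `FSV2018_thm9_commROABP_holds` (commutative roABPs), `FSV2018_thm9_sparseTrdeg_holds`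
(circuits composed with sparse polynomials of transcendence degree `≤ r`); the seventh (occur
formulas) is consumed conditionally in `BarrierLeverSuccinctHittingSetsForVPOccurFormulas.lean`.
Each bullet says: the multilinear `ΣΠΣ` formulas of width `W` (`W = (⌊log₂ s⌋ + n + 2)^c`,
`(⌈log₂ w⌉ + n + 2)^c` or `(n + 2)^c`) are a succinct hitting set, in the space of multilinear
polynomials (`M = multilinearMonomials n`, `N = 2^n` coefficient variables), for the bullet's class.

This file turns each into the tree's barrier vocabulary, UNCONDITIONALLY: by the bridge
`Occur.multilinearSPS_subset_smallCircuits_inter` (multilinear `ΣΠΣ` of width `W` ⊆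
`SmallCircuits ℂ n b ∩ multilinearSlice ℂ n` once `W(4n+5) ≤ n^b`) and the width arithmetic in the
regime `s, w ≤ 2^{n^a}` (which contains `poly(N)`), for every bullet there are `b, n₀` such that for
`n ≥ n₀` the MULTILINEAR members of `SmallCircuits ℂ n b` hit every nonzero distinguisher of the
class (`isSuccinctHittingSet_spskML/_trdegML/_sparseML/_smespML/_commROABPML/_sparseTrdegML`), and
no member of the class is an algebraically natural proof against `SmallCircuits ℂ n b' ∩
multilinearSlice ℂ n`, `b' ≥ b` (`not_isNaturalProof_of_isSuccinctHittingSet`).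

HONEST FRAMING. These are SLICES in the MULTILINEAR frame. The rung
`Theses.BarrierLever.SuccinctHittingSetsForVP` lives in the frame `H = degLEMonomials n` (degree
`≤ n`, `N = binom(2n,n)`) and asks for ALL `poly(N)`-size distinguishers; that frame is NOT reached
here (restriction of a nonzero `degLE`-distinguisher to the multilinear coordinates can vanish — no
transfer attempted), the rung stays OPEN, and `VP ≠ VNP` is NOT proved. No `sorry`, no named-fact
hypotheses, no definitions.

References: [ForbesShpilkaVolk2018] M. A. Forbes, A. Shpilka, B. L. Volk, Theory Comput. 14 (2018),
Def. 1, Def. 3, Thm. 4, Cor. 5, Thm. 9 (= ToC Thm. 1.10) bullets 1–5 and 7; Cor. 22, Thm. 24,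
Cor. 34, Thm. 37, Cor. 44, Cor. 54.
-/

-- layout Summits/ValiantsHypothesis/ValiantsHypothesis forces the duplicated namespace component
set_option linter.dupNamespace false

noncomputable section

namespace Summit.ValiantsHypothesis.ValiantsHypothesis.Theorems.BarrierLever.SuccinctHittingSetsForVP

open Literature.Barriers.ValiantsHypothesis Literature.Computability.AlgebraicComplexity MvPolynomial

namespace Occur

/-! ### Generic consumer and width arithmetic -/

/-- **Generic consumer**: a bullet of FSV Thm. 9 (`MultilinearSPSHits ℂ n W 𝒟`) with
`W(4n+5) ≤ n^b` makes the multilinear members of `SmallCircuits ℂ n b` a succinct hitting set for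
`𝒟` in the multilinear frame. [cite: ForbesShpilkaVolk2018, Thm. 9 and Cor. 5 (= ToC Thm. 1.10, Cor. 1.5)] -/
theorem isSuccinctHittingSet_of_multilinearSPSHits {n W b : ℕ}
    {𝒟 : Set (MvPolynomial (multilinearMonomials n) ℂ)} (h : MultilinearSPSHits ℂ n W 𝒟)
    (hW : W * (4 * n + 5) ≤ n ^ b) :
    IsSuccinctHittingSet (multilinearMonomials n) (SmallCircuits ℂ n b ∩ multilinearSlice ℂ n) 𝒟 :=
  h.mono (multilinearSPS_subset_smallCircuits_inter hW) le_rfl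

/-- **Width arithmetic, `⌊log₂⌋` shape**: for `n ≥ 3`, `s ≤ 2^{n^a}`,
`(⌊log₂ s⌋ + n + 2)^c (4n+5) ≤ n^{2((a+1)c+2)}`. [folklore] -/
theorem width_arith_log {n a c s : ℕ} (hn : 3 ≤ n) (hs : s ≤ 2 ^ (n ^ a)) :
    (Nat.log 2 s + n + 2) ^ c * (4 * n + 5) ≤ n ^ (2 * ((a + 1) * c + 2)) := by
  refine le_trans ?_ (width_arith hn hs)
  have h : Nat.log 2 s + n + 2 ≤ Nat.clog 2 s + n + 2 := by
    have := Nat.log_le_clog 2 s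
    omega
  exact Nat.mul_le_mul_right _ (Nat.pow_le_pow_left h c)

/-- **Width arithmetic, constant shape**: for `n ≥ 3`, `(n + 2)^c (4n+5) ≤ n^{2(c+2)}`. [folklore] -/
theorem width_arith_const {n c : ℕ} (hn : 3 ≤ n) :
    (n + 2) ^ c * (4 * n + 5) ≤ n ^ (2 * (c + 2)) := by
  have h := width_arith (a := 0) (c := c) (s := 0) hn (Nat.zero_le _)
  simp only [Nat.clog_zero_right, zero_add, one_mul] at h
  exact h

/-- **Hitting sets exclude natural proofs, uniformly in the size exponent**: if the multilinear
members of `SmallCircuits ℂ n b` hit `𝒟` (`n ≥ 1`), then no `Δ ∈ 𝒟` is an algebraically natural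
proof against `SmallCircuits ℂ n b' ∩ multilinearSlice ℂ n` for any `b' ≥ b` and any ambient class
`𝒟'` (FSV Def. 1 / Thm. 4; `smallCircuits_mono`). [cite: ForbesShpilkaVolk2018, Def. 1 and Thm. 4] -/
theorem not_isNaturalProof_of_isSuccinctHittingSet {n b b' : ℕ} (hn : 1 ≤ n) (hbb' : b ≤ b')
    {𝒟 : Set (MvPolynomial (multilinearMonomials n) ℂ)}
    (h : IsSuccinctHittingSet (multilinearMonomials n) (SmallCircuits ℂ n b ∩ multilinearSlice ℂ n) 𝒟)
    (𝒟' : Set (MvPolynomial (multilinearMonomials n) ℂ)) {Δ : MvPolynomial (multilinearMonomials n) ℂ}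
    (hΔ : Δ ∈ 𝒟) :
    ¬ IsNaturalProof (multilinearMonomials n) (SmallCircuits ℂ n b' ∩ multilinearSlice ℂ n) 𝒟' Δ := by
  rintro ⟨-, hΔ0, hvan⟩
  obtain ⟨f, ⟨hf, hfm⟩, hne⟩ := h Δ hΔ hΔ0
  exact hne (hvan f ⟨smallCircuits_mono ℂ hbb' hn hf, hfm⟩)

end Occur

open Occur

/-! ### The six unconditional slices -/

/-- **Bullet 1, `Σ^kΠΣ` formulas (unconditional, multilinear frame).** For all `k a` there are
`b n₀` with: for `n ≥ n₀` and `s ≤ 2^{n^a}`, the multilinear members of `SmallCircuits ℂ n b` hit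
every nonzero `Σ^kΠΣ` distinguisher of degree `≤ s` in the `2^n` multilinear coefficient variables
(`FSV2018_thm9_spsk_holds`, via Cor. 22 / Fact 19, discharged by the tree's Saxena–Seshadhri
reduction). [cite: ForbesShpilkaVolk2018, Thm. 9 bullet 1 and Cor. 22 (= ToC Thm. 1.10, Cor. 4.7)] -/
theorem isSuccinctHittingSet_spskML (k a : ℕ) :
    ∃ b n₀ : ℕ, ∀ n, n₀ ≤ n → ∀ s, s ≤ 2 ^ (n ^ a) →
      IsSuccinctHittingSet (multilinearMonomials n) (SmallCircuits ℂ n b ∩ multilinearSlice ℂ n)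
        (spskClass ℂ (multilinearMonomials n) k s) := by
  obtain ⟨c, hc⟩ := FSV2018_thm9_spsk_holds k
  exact ⟨2 * ((a + 1) * c + 2), 3, fun n hn s hs =>
    isSuccinctHittingSet_of_multilinearSPSHits (hc ℂ n s) (width_arith_log hn hs)⟩

/-- **Bullet 2, `ΣΠΣ` formulas of transcendence degree `≤ k` (unconditional, multilinear frame).**
For all `k` there are `b n₀` with: for `n ≥ n₀` and every `d`, the multilinear members of
`SmallCircuits ℂ n b` hit every nonzero `C(T_1, …, T_M)` with `T_i` products of `≤ d` linear forms of
transcendence degree `≤ k` (`FSV2018_thm9_trdeg_holds`, Thm. 24; characteristic `0`).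
[cite: ForbesShpilkaVolk2018, Thm. 9 bullet 2 and Thm. 24 (= ToC Thm. 1.10, Thm. 4.9)] -/
theorem isSuccinctHittingSet_trdegML (k : ℕ) :
    ∃ b n₀ : ℕ, ∀ n, n₀ ≤ n → ∀ d,
      IsSuccinctHittingSet (multilinearMonomials n) (SmallCircuits ℂ n b ∩ multilinearSlice ℂ n)
        (trdegProductClass ℂ (multilinearMonomials n) k d) := by
  obtain ⟨c, hc⟩ := FSV2018_thm9_trdeg_holds k
  exact ⟨2 * (c + 2), 3, fun n hn d =>
    isSuccinctHittingSet_of_multilinearSPSHits (hc ℂ n d (Or.inl ringChar.eq_zero))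
      (width_arith_const hn)⟩

/-- **Bullet 3, sparse polynomials (unconditional, multilinear frame).** For all `a` there are
`b n₀` with: for `n ≥ n₀` and `s ≤ 2^{n^a}`, the multilinear members of `SmallCircuits ℂ n b` hit
every nonzero distinguisher with `≤ s` monomials (`FSV2018_thm9_sparse_holds`, Cor. 34).
[cite: ForbesShpilkaVolk2018, Thm. 9 bullet 3 and Cor. 34 (= ToC Thm. 1.10, Cor. 5.10)] -/
theorem isSuccinctHittingSet_sparseML (a : ℕ) :
    ∃ b n₀ : ℕ, ∀ n, n₀ ≤ n → ∀ s, s ≤ 2 ^ (n ^ a) →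
      IsSuccinctHittingSet (multilinearMonomials n) (SmallCircuits ℂ n b ∩ multilinearSlice ℂ n)
        {D : MvPolynomial (multilinearMonomials n) ℂ | D.support.card ≤ s} := by
  obtain ⟨c, hc⟩ := FSV2018_thm9_sparse_holds
  exact ⟨2 * ((a + 1) * c + 2), 3, fun n hn s hs =>
    isSuccinctHittingSet_of_multilinearSPSHits (hc ℂ n s) (width_arith_log hn hs)⟩

/-- **Bullet 4, `Σm∧ΣΠ^t` formulas (unconditional, multilinear frame).** For all `t a` there are
`b n₀` with: for `n ≥ n₀` and `s ≤ 2^{n^a}`, the multilinear members of `SmallCircuits ℂ n b` hit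
every nonzero `Σm∧ΣΠ^t` formula of top fan-in `≤ s` (`FSV2018_thm9_smesp_holds`, Thm. 37; the
characteristic clause of the typed fact is vacuous over `ℂ`).
[cite: ForbesShpilkaVolk2018, Thm. 9 bullet 4 and Thm. 37 (= ToC Thm. 1.10, Thm. 5.13)] -/
theorem isSuccinctHittingSet_smespML (t a : ℕ) :
    ∃ b n₀ : ℕ, ∀ n, n₀ ≤ n → ∀ s, s ≤ 2 ^ (n ^ a) →
      IsSuccinctHittingSet (multilinearMonomials n) (SmallCircuits ℂ n b ∩ multilinearSlice ℂ n)
        (smespClass ℂ (multilinearMonomials n) s t) := by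
  obtain ⟨c, hc⟩ := FSV2018_thm9_smesp_holds t
  refine ⟨2 * ((a + 1) * c + 2), 3, fun n hn s hs => ?_⟩
  refine (isSuccinctHittingSet_of_multilinearSPSHits (hc ℂ n s) (width_arith_log hn hs)).mono
    le_rfl fun P hP => ?_
  exact ⟨hP, Or.inl ringChar.eq_zero⟩

/-- **Bullet 5, commutative roABPs (unconditional, multilinear frame).** For all `a` there are
`b n₀` with: for `n ≥ n₀`, every width `w ≤ 2^{n^a}` and every individual degree `d`, the
multilinear members of `SmallCircuits ℂ n b` hit every nonzero distinguisher computed by a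
commutative roABP of width `w` and individual degree `d` (`FSV2018_thm9_commROABP_holds`, Cor. 44).
[cite: ForbesShpilkaVolk2018, Thm. 9 bullet 5 and Cor. 44 (= ToC Thm. 1.10, Cor. 5.20)] -/
theorem isSuccinctHittingSet_commROABPML (a : ℕ) :
    ∃ b n₀ : ℕ, ∀ n, n₀ ≤ n → ∀ w, w ≤ 2 ^ (n ^ a) → ∀ d,
      IsSuccinctHittingSet (multilinearMonomials n) (SmallCircuits ℂ n b ∩ multilinearSlice ℂ n)
        (commROABPClass ℂ n w d) := by
  obtain ⟨c, hc⟩ := FSV2018_thm9_commROABP_holds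
  exact ⟨2 * ((a + 1) * c + 2), 3, fun n hn w hw d =>
    isSuccinctHittingSet_of_multilinearSPSHits (hc ℂ n w d) (width_arith hn hw)⟩

/-- **Bullet 7, circuits composed with `s`-sparse polynomials of transcendence degree `≤ r`
(unconditional, multilinear frame).** For all `r a` there are `b n₀` with: for `n ≥ n₀`,
`s ≤ 2^{n^a}` and every degree bound `d`, the multilinear members of `SmallCircuits ℂ n b` hit every
nonzero member of `sparseTrdegClass ℂ _ r s d` (`FSV2018_thm9_sparseTrdeg_holds`, Cor. 54;
characteristic `0`). [cite: ForbesShpilkaVolk2018, Thm. 9 bullet 7 and Cor. 54 (= ToC Thm. 1.10, Cor. 6.5)] -/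
theorem isSuccinctHittingSet_sparseTrdegML (r a : ℕ) :
    ∃ b n₀ : ℕ, ∀ n, n₀ ≤ n → ∀ s, s ≤ 2 ^ (n ^ a) → ∀ d,
      IsSuccinctHittingSet (multilinearMonomials n) (SmallCircuits ℂ n b ∩ multilinearSlice ℂ n)
        (sparseTrdegClass ℂ (multilinearMonomials n) r s d) := by
  obtain ⟨c, hc⟩ := FSV2018_thm9_sparseTrdeg_holds r
  exact ⟨2 * ((a + 1) * c + 2), 3, fun n hn s hs d =>
    isSuccinctHittingSet_of_multilinearSPSHits (hc ℂ n s d (Or.inl ringChar.eq_zero))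
      (width_arith_log hn hs)⟩

end Summit.ValiantsHypothesis.ValiantsHypothesis.Theorems.BarrierLever.SuccinctHittingSetsForVP

end
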